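import Literature.MathematicalPhysics.QuantumFieldTheory.Balaban1983to89.B4Lemma22ReduceDeriv
import Literature.MathematicalPhysics.QuantumFieldTheory.Balaban1983to89.B4Thm19ZeroBoxHolder
import Literature.MathematicalPhysics.QuantumFieldTheory.Balaban1983to89.B4Lemma22CrossSup

/-!
# [B4] Lemma 2.2, (2.16): the HÖLDER member of `‖G_k(□,Ã)f‖_{1,α} ≤ c₁‖f‖_∞` on fine boxes

Audit cell `pub-balaban`, paper sub-cell B04 — a kernel certificate for one printed step of
[Balaban1983RegularityDecay] (T. Bałaban, *Regularity and decay of lattice Green's functions*, Commun. Math.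
Phys. 89 (1983) 571–597), in the typing of the lineage `B4Lemma22ReduceZero` / `B4Lemma22ReduceDeriv` /
`B4Thm19ZeroBoxHolder`.

THE PRINTED STEP.  Lemma 2.2 asserts «(2.16) ‖G_k(□,Ã)f‖_{1,α} ≤ c₁‖f‖_∞,» in the norm
«(2.14) ‖f‖_{1,α} = max{sup_x|f(x)|, sup_{x,μ}|(D^η_{A,μ}f)(x)|, sup_{x,x',μ} |x'−x|^{−α}|U(A(Γ_{x,x'}))(D^η_{A,μ}f)(x') − (D^η_{A,μ}f)(x)|},»
(«it will be understood that the same vector field is in the norm (2.14) as in these expressions»; `Γ_{x,x'}` is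
«a shortest contour connecting these points»).  The proof, p. 581: «Let us assume that Lemma 2.2 holds for
G_k(□,A₀) with constant configurations A₀. We will prove it for a general case using (2.31).» …
«Now using Lemma 2.2 for G_k(□,A₀) and the decomposition D^η_Ã = U(A')D^η_{A₀} + F_{1,k}(A'), we have»
«(2.33) ‖G_k(□,Ã)f‖_{1,α} ≤ O(1)c₁ Σ_{n=0}^∞ ‖(V_kG_k(□,A₀))^nf‖_∞ ≤ O(1)c₁ Σ_{n=0}^∞ (O(1)e^βc₂)^n‖f‖_∞.»
«The series on the right hand side is convergent for e sufficiently small, and we get the inequality (2.16).»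
and «Lemma 2.2 in the case of a constant configuration A₀ is equivalent to the case of configuration A₀ = 0 by
the same argument with the gauge transformation as before.»  The two SUP members of (2.14) for `G_k(□,Ã)f` are
certified in `B4Lemma22ReduceDeriv.lemma22_17_sup_field_regular`; this file certifies the remaining, HÖLDER,
member — the one for which (2.33)'s first inequality is not a one-liner, because the transport `U(Ã(Γ_{x,x'}))`
and the two evaluation points interact with the decomposition `D^η_Ã = U(A')D^η_{A₀} + F_{1,k}(A')`.

WHAT IS CERTIFIED (fine box `Box d ℓ k M` of `n·M_i` sites a side, `n = (ℓ+1)^k = η^{-1}`; internal space `ι`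
carrying the lineage's abelian one-parameter orthogonal flow `F : OrthFlow ι`, link variables `U(κA_b) = F.U (κA_b)`;
`G_k(□,A) = greenA …`, `D^η_{A,μ} = derivA …` = `n`·(forward covariant difference), `‖·‖_∞ = supN`):
* §1–§2 contour bookkeeping — the bond sum `A(Γ)` (`pathSum`, [B4] (1.4) «A(Γ) = Σ_{b⊂Γ} A_b»), the transport
  `U(A(Γ)) = F.U(κA(Γ))` of the commuting link variables (`transport_fieldLink`), the gauge triviality
  `U(A₀(Γ)) = g(x)g(x')ᵀ` of a constant configuration (`transport_constBond`), `|κA(Γ)| ≤ |Γ|·max_b|κA_b|` on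
  nearest-neighbour chains, telescoping along a chain, flow Lipschitz facts, and the Hölder weight:
  `(n/s)^α·(s/n) ≤ 1` for `s ≤ n`, `(n/s)^α ≤ 1` for `s ≥ n` (`s = |x'−x|_∞` in lattice units).
* §3–§4 the pieces: the zero-field doubly differenced row in vector form, the variation of `g` over a bond through
  `D^η_{A₀}g`, and the sitewise form of `(D^η_Ã − D^η_{A₀})g` (from `B4Lemma22ReduceDeriv.covDeriv_sub_fld_of_mem`).
* §5 `holder_const_green` — THE KEY ESTIMATE («Lemma 2.2 for G_k(□,A₀)» composed with the decomposition): for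
  `g = G_k(□,A₀)Φ`, `(n/s)^α·|U(Ã(Γ))(D^η_{Ã,μ}g)(x') − (D^η_{Ã,μ}g)(x)| ≤ c₁‖Φ‖_∞` for every
  nearest-neighbour chain `Γ` from `x` to `x'` with `|Γ| ≤ (d+1)s`, uniformly in `k`, the box, `A₀`, `A'`.
* §6 `lemma22_16_holder_field` — THE PRINTED STEP: the same bound, with constant `2c₁`, for `G_k(□,Ã)`,
  `Ã = A₀ + A'`, in resolvent form `G = G_k(□,A₀) + G_k(□,A₀)V_kG` (the summed (2.31),
  `B4Lemma22ReduceZero.greenA_resolvent`) under the tree's smallness `FirstOrderSmall … ε`, `((d+2)c)ε ≤ 1/2`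
  — by `B4Lemma22ReduceZero.lemma22_16_transfer_const` ((2.33) for an arbitrary subadditive functional).
  With `lemma22_17_sup_field_regular` this bounds every member of (2.14) for `G_k(□,Ã)Φ` by `O(1)‖Φ‖_∞`:
  (2.16) on fine boxes, constants depending on `d`, `ℓ = L − 1`, `ℓ₁`, `α` and the parameter window only.
* §7 `lemma22_16_holder_field_explicit` (v2) — the same with `V_k`'s first-order smallness DISCHARGED from the
  (2.23)-type field hypotheses of `B4Lemma22CrossSup.lemma22_17_sup_box` (size `θ/n`, second differences `θ₂/n²`,
  vanishing on the bonds at the faces, block-contour sums `τ`, the explicit polynomial smallness condition), by the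
  tree's `B4Lemma22CrossSup.firstOrderSmall_cross` + `B4Lemma22PertVSup.firstOrderSmall_pertV`.

HOW (the mathematics behind (2.33)'s first inequality for the Hölder member, which [B4] leaves to the reader).
`D_Ã g = D_{A₀}g + E`, `E(y) = n(U(κA'(y,y+e_μ)) − 1)U(κA₀,μ)g(y+e_μ)`; `U(Ã(Γ)) = U(A₀(Γ))U(A'(Γ))` (commuting
link variables) and `U(A₀(Γ_{x,x'})) = g_{A₀}(x)g_{A₀}(x')ᵀ`.  The transported difference splits into:
(i-b) the `A₀`-gauge image of the ZERO-FIELD doubly differenced kernel row, bounded together with the weight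
`(n/s)^α` by the tree's (1.9)-row estimate `B4Thm19ZeroBoxHolder.thm19_zero_box_holder_roww` — this is the Hölder
member of «Lemma 2.2 for G_k(□,A₀)», reached from `A₀ = 0` by the gauge transformation
(`B4GaugeCovariance.b4Green_constBond`, `B4Lemma22ReduceZero.covDeriv_constBond`); (i-a), (ii-a) the defects of
the `A'`-transport, `≤ ℓ₁|κA'(Γ)|·sup ≤ O(1)θ·(s/n)‖Φ‖_∞`; (ii-b) the variation of `E` between `x` and `x'`,
controlled by the bond-DIFFERENCE bound on `A'` and by the variation of `g` along `Γ ∪ {bonds at x, x'}`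
(telescoped covariant differences, `B4Lemma22ReduceZero.const_box_sup`).  Every defect carries one factor
`s/n = |x − x'|` (physical), which absorbs the weight since `α ≤ 1`; for `|x − x'| > 1` the weight is `≤ 1` and the
sup bounds suffice.

HONEST SCOPE / NOT CLAIMED.  (1) Fine boxes only (the setting of Lemma 2.2), in the lineage's typing
(`boxOpR`-kernel, block averaging `blkWt`, `emb`/`Γ` contour system with `hend`); nothing about general `Ω`.
(2) The internal symmetry is the lineage's ABELIAN one-parameter orthogonal flow with Lipschitz modulus `ℓ₁`
(`hLip`); for a non-abelian structure group the splitting `U(Ã(Γ)) = U(A₀(Γ))U(A'(Γ))` fails as used in (i) and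
nothing is certified.  (3) FIELD HYPOTHESES, in lattice units: `|κA₀,ν| ≤ θ/n`, `|κA'_b| ≤ θ/n` on nearest-neighbour
bonds, and the bond-difference bound `|κ(A'(x',x'+e_μ) − A'(x,x+e_μ))| ≤ θ'|x'−x|_∞/n²`, `θ, θ' ≤ 1` — our explicit
reading of the regularity «(2.23) A = A₀ + A', |A'|, |∂^η_μA'| ≤ c'e^{β−1},» that (2.33) uses silently for the
Hölder member (GAPS C-b04g15-6); the smallness of `V_k` is the tree's `FirstOrderSmall`/`ε` exactly as in
`lemma22_17_sup_field_regular` («for e sufficiently small») in §6, and is discharged in §7 from the same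
(2.23)-type hypotheses as the lineage's (2.17)_∞ (`B4Lemma22CrossSup.lemma22_17_sup_box`: second differences
`θ₂/n²`, vanishing on the bonds at the faces, block-contour sums `≤ τ`); `θ, θ' ≤ 1` is a normalisation (small
field), not a loss.  (4) CONTOURS: proved for EVERY nearest-neighbour chain inside the box with `|Γ| ≤ (d+1)|x'−x|_∞`
(`d+1` = number of lattice directions in the lineage's indexing); every shortest lattice contour between two
points of a box lies in the box and has `|Γ| = |x'−x|_1 ≤ (d+1)|x'−x|_∞`, so [B4]'s choice is covered and
immaterial.  (5) Constants: `c₁ = c_H + 3(d+3)(1+ℓ₁)²c'` (`c_H` the zero-field Hölder row constant, `c'` the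
constant-field sup constant of the tree): `O(1)` in [B4]'s sense, with no attempt at its numerical value; [B4]'s
"c₁ depending on d, α only" is not examined (ours depends on the window and `L` through the tree's inputs).
(6) This is a certificate that the printed argument (2.31)–(2.33) ⇒ (2.16) is correct for the Hölder member in
this typing GIVEN the zero-field input already in the tree; it is not progress on any summit statement.
-/

namespace Literature.MathematicalPhysics.QuantumFieldTheory.Balaban1983to89.B4Lemma22HolderBox

open Finset Matrix
open scoped Kronecker
open Literature.MathematicalPhysics.QuantumFieldTheory.Balaban1983to89.B4GaugeCovariance
open Literature.MathematicalPhysics.QuantumFieldTheory.Balaban1983to89.B4Lower18Regular (e1 kmul kmul_apply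
  fieldLink_add)
open Literature.MathematicalPhysics.QuantumFieldTheory.Balaban1983to89.B4Lemma21Region (siteNorm covDeriv dirKer
  fld_covDeriv_mulVec_of_mem)
open Literature.MathematicalPhysics.QuantumFieldTheory.Balaban1983to89.B4Reflection242 (boxDom nbrs mem_nbrs)
open Literature.MathematicalPhysics.QuantumFieldTheory.Balaban1983to89.B4ContourShift (supNorm supNorm_nonneg)
open Literature.MathematicalPhysics.QuantumFieldTheory.Balaban1983to89.B4StripSumsHolder (one_le_supNorm)
open Literature.MathematicalPhysics.QuantumFieldTheory.Balaban1983to89.B4Lemma22Reduce231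
open Literature.MathematicalPhysics.QuantumFieldTheory.Balaban1983to89.B4Lemma22ReduceDeriv (siteNorm_flow
  siteNorm_flow_sub_one_le covDeriv_sub_fld_of_mem covDeriv_sub_supN_le_nbrs add_e1_mem_nbrs)
open Literature.MathematicalPhysics.QuantumFieldTheory.Balaban1983to89.B4Lemma22ReduceZero

noncomputable section

variable {ι : Type} [Fintype ι] [DecidableEq ι]

/-! ## §1 Contours: the bond sum `A(Γ)`, the transport `U(A(Γ))` of the abelian flow, nearest-neighbour chains -/

section Contour

variable {X : Type*}

/-- `A(Γ) = Σ_{b ⊂ Γ} A_b` — the sum of the bond function along the contour starting at `x` and visiting the listed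
sites in order ([B4] p. 572 «A(Γ) = Σ_{b⊂Γ} A_b»). [cite: Balaban1983RegularityDecay, p. 572 (1.4)] -/
def pathSum (A : X → X → ℝ) : X → List X → ℝ
  | _, [] => 0
  | x, y :: l => A x y + pathSum A y l

omit [Fintype ι] [DecidableEq ι] in
/-- `pathSum` is additive in the bond function. [folklore] -/
theorem pathSum_add (A B : X → X → ℝ) (x : X) (l : List X) :
    pathSum (A + B) x l = pathSum A x l + pathSum B x l := by
  induction l generalizing x with
  | nil => simp [pathSum]
  | cons y l ih => simp only [pathSum, Pi.add_apply, ih]; ring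

/-- **`U(A(Γ)) = U(κΣ_bA_b)`**: for the commuting link variables `U(κA_b)` of the flow the transport along a contour
is the flow at the bond sum. [cite: Balaban1983RegularityDecay, p. 572 (1.4) «U(A(Γ^{(k)}_{y,x}))»] -/
theorem transport_fieldLink (F : OrthFlow ι) (κ : ℝ) (A : X → X → ℝ) (x : X) (l : List X) :
    transport (fieldLink F κ A) x l = F.U (κ * pathSum A x l) := by
  induction l generalizing x with
  | nil => simp [transport, pathSum, F.map_zero]
  | cons y l ih =>
      simp only [transport, pathSum, ih, fieldLink, mul_add]
      rw [F.map_add]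

/-- the transport of the CONSTANT configuration is gauge-trivial: `U(A₀(Γ)) = g(start)·g(end)ᵀ`,
`g = U(κλ)`, `λ = −⟨A₀,·⟩` — independent of the contour. [cite: Balaban1983RegularityDecay, p. 581] -/
theorem transport_constBond {d : ℕ} (F : OrthFlow ι) (κ : ℝ) (A₀ : Fin (d + 1) → ℝ)
    (pos : X → (Fin (d + 1) → ℤ)) (x : X) (l : List X) :
    transport (fieldLink F κ (constBond A₀ pos)) x l
      = F.U (κ * linGauge A₀ pos x) * (F.U (κ * linGauge A₀ pos (pathEnd x l)))ᵀ := by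
  rw [fieldLink_constBond, transport_gauge (F.isGauge _), transport_one, Matrix.mul_one]

variable {d : ℕ} {R : Finset (Fin (d + 1) → ℤ)}

/-- a NEAREST-NEIGHBOUR CHAIN in the region: consecutive sites of the contour `x, l₀, l₁, …` are lattice
neighbours (`l_{i+1} = l_i ± e_ν`). [cite: Balaban1983RegularityDecay, p. 573 «a shortest contour connecting these points»] -/
def IsNNChain : ↥R → List ↥R → Prop
  | _, [] => True
  | x, y :: l => y.1 ∈ nbrs x.1 ∧ IsNNChain y l

omit [Fintype ι] [DecidableEq ι] in
/-- along a nearest-neighbour chain a bondwise bound `|κA_b| ≤ b` sums to `|κA(Γ)| ≤ |Γ|·b`. [folklore] -/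
theorem abs_pathSum_le {κ b : ℝ} {A : ↥R → ↥R → ℝ} (hA : ∀ x y : ↥R, y.1 ∈ nbrs x.1 → |κ * A x y| ≤ b)
    (x : ↥R) (l : List ↥R) (hl : IsNNChain x l) : |κ * pathSum A x l| ≤ l.length * b := by
  induction l generalizing x with
  | nil => simp [pathSum]
  | cons y l ih =>
      obtain ⟨hy, hl'⟩ := hl
      simp only [pathSum, List.length_cons, Nat.cast_succ, mul_add]
      calc |κ * A x y + κ * pathSum A y l| ≤ |κ * A x y| + |κ * pathSum A y l| := abs_add_le _ _
        _ ≤ b + l.length * b := add_le_add (hA x y hy) (ih y hl')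
        _ = (l.length + 1) * b := by ring

omit [Fintype ι] [DecidableEq ι] in
/-- the constant field on a nearest-neighbour bond is `±A₀,ν`. [folklore] -/
theorem constBond_nbrs (A₀ : Fin (d + 1) → ℝ) {x y : ↥R} (h : y.1 ∈ nbrs x.1) :
    ∃ ν, constBond A₀ Subtype.val x y = A₀ ν ∨ constBond A₀ Subtype.val x y = -A₀ ν := by
  obtain ⟨ν, hν | hν⟩ := mem_nbrs.1 h
  · refine ⟨ν, Or.inl ?_⟩
    simp only [constBond, hν, Pi.add_apply, Int.cast_add, add_sub_cancel_left]
    rw [Finset.sum_eq_single ν]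
    · simp
    · intro μ _ hμ; simp [hμ]
    · intro h; exact absurd (Finset.mem_univ ν) h
  · refine ⟨ν, Or.inr ?_⟩
    simp only [constBond, hν, Pi.sub_apply, Int.cast_sub, sub_sub_cancel_left]
    rw [Finset.sum_eq_single ν]
    · simp
    · intro μ _ hμ; simp [hμ]
    · intro h; exact absurd (Finset.mem_univ ν) h

omit [Fintype ι] [DecidableEq ι] in
/-- the constant field on the forward bond `⟨x, x + e_μ⟩` is `A₀,μ`. [folklore] -/
theorem constBond_fwd (A₀ : Fin (d + 1) → ℝ) {x y : ↥R} {μ : Fin (d + 1)} (h : y.1 = x.1 + e1 μ) :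
    constBond A₀ Subtype.val x y = A₀ μ := by
  simp only [constBond, h, e1, Pi.add_apply, Int.cast_add, add_sub_cancel_left]
  rw [Finset.sum_eq_single μ]
  · simp
  · intro ν _ hν; simp [hν]
  · intro h; exact absurd (Finset.mem_univ μ) h

omit [Fintype ι] [DecidableEq ι] in
/-- bondwise size of the constant field: `|κA₀(x,y)| ≤ θ/n` on nearest-neighbour bonds from `|κA₀,ν| ≤ θ/n`.
[folklore] -/
theorem constBond_nbrs_abs_le (A₀ : Fin (d + 1) → ℝ) {κ t : ℝ} (hA0 : ∀ ν, |κ * A₀ ν| ≤ t) {x y : ↥R}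
    (h : y.1 ∈ nbrs x.1) : |κ * constBond A₀ Subtype.val x y| ≤ t := by
  obtain ⟨ν, hν | hν⟩ := constBond_nbrs A₀ h
  · rw [hν]; exact hA0 ν
  · rw [hν, mul_neg, abs_neg]; exact hA0 ν

omit [DecidableEq ι] in
/-- TELESCOPING ALONG A CHAIN: a bound `B` on the variation of `Φ` over every bond gives
`|Φ(end) − Φ(start)| ≤ |Γ|·B`. [folklore] -/
theorem chain_variation_le (Φ : ↥R × ι → ℝ) {B : ℝ}
    (hB : ∀ (ν : Fin (d + 1)) (y ye : ↥R), ye.1 = y.1 + e1 ν → siteNorm (fld Φ ye - fld Φ y) ≤ B)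
    (x : ↥R) (l : List ↥R) (hl : IsNNChain x l) :
    siteNorm (fld Φ (pathEnd x l) - fld Φ x) ≤ l.length * B := by
  induction l generalizing x with
  | nil => simp [pathEnd, siteNorm_zero]
  | cons y l ih =>
      obtain ⟨hy, hl'⟩ := hl
      simp only [pathEnd, List.length_cons, Nat.cast_succ]
      have hstep : siteNorm (fld Φ y - fld Φ x) ≤ B := by
        obtain ⟨ν, hν | hν⟩ := mem_nbrs.1 hy
        · exact hB ν x y hν
        · have hx : x.1 = y.1 + e1 ν := by rw [hν, e1]; abel
          have := hB ν y x hx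
          rwa [← neg_sub, show -(fld Φ y - fld Φ x) = (-1 : ℝ) • (fld Φ y - fld Φ x) by simp,
            siteNorm_smul, abs_neg, abs_one, one_mul] at this
      calc siteNorm (fld Φ (pathEnd y l) - fld Φ x)
          = siteNorm ((fld Φ (pathEnd y l) - fld Φ y) + (fld Φ y - fld Φ x)) := by rw [sub_add_sub_cancel]
        _ ≤ siteNorm (fld Φ (pathEnd y l) - fld Φ y) + siteNorm (fld Φ y - fld Φ x) := siteNorm_add_le _ _
        _ ≤ l.length * B + B := add_le_add (ih y hl') hstep
        _ = (l.length + 1) * B := by ring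

end Contour

/-! ## §2 Flow facts: differences of link variables, the Hölder weight -/

section Flow

/-- **`|(U(s) − U(t))v| ≤ ℓ|s − t|·|v|`** (the flow is a commuting group of isometries). [folklore] -/
theorem siteNorm_flow_sub_flow_le (F : OrthFlow ι) {ℓ₁ : ℝ} (hℓ₁ : 0 ≤ ℓ₁)
    (hLip : ∀ t (v : ι → ℝ), ((F.U t - 1) *ᵥ v) ⬝ᵥ ((F.U t - 1) *ᵥ v) ≤ (ℓ₁ * t) ^ 2 * (v ⬝ᵥ v))
    (s t : ℝ) (v : ι → ℝ) : siteNorm ((F.U s - F.U t) *ᵥ v) ≤ ℓ₁ * |s - t| * siteNorm v := by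
  have h : F.U s - F.U t = F.U t * (F.U (s - t) - 1) := by
    rw [Matrix.mul_sub, Matrix.mul_one, ← F.map_add, add_sub_cancel]
  rw [h, ← mulVec_mulVec, siteNorm_flow]
  exact siteNorm_flow_sub_one_le F hℓ₁ hLip (s - t) v

/-- `|U(s)(U(t) − 1)v| = |(U(t) − 1)v| ≤ ℓ|t||v|` packaged: `|U(s+t)v − U(s)v| ≤ ℓ|t||v|`. [folklore] -/
theorem siteNorm_flow_mul_sub_le (F : OrthFlow ι) {ℓ₁ : ℝ} (hℓ₁ : 0 ≤ ℓ₁)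
    (hLip : ∀ t (v : ι → ℝ), ((F.U t - 1) *ᵥ v) ⬝ᵥ ((F.U t - 1) *ᵥ v) ≤ (ℓ₁ * t) ^ 2 * (v ⬝ᵥ v))
    (T : Matrix ι ι ℝ) (hT : ∀ w, siteNorm (T *ᵥ w) = siteNorm w) (t : ℝ) (v : ι → ℝ) :
    siteNorm ((T * F.U t) *ᵥ v - T *ᵥ v) ≤ ℓ₁ * |t| * siteNorm v := by
  rw [← mulVec_mulVec, ← mulVec_sub, hT, show F.U t *ᵥ v - v = (F.U t - 1) *ᵥ v by
    rw [sub_mulVec, one_mulVec]]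
  exact siteNorm_flow_sub_one_le F hℓ₁ hLip t v

omit [Fintype ι] [DecidableEq ι] in
/-- THE HÖLDER WEIGHT AGAINST ONE POWER OF THE SEPARATION: for `0 < s ≤ n` and `α ≤ 1`,
`(n/s)^α·(s/n) ≤ 1` (`= (s/n)^{1−α}`; physical separations `|x − x′| = s/n ≤ 1`). [folklore] -/
theorem holderWt_mul_ratio_le_one {n s α : ℝ} (hs : 0 < s) (hsn : s ≤ n) (hα1 : α ≤ 1) :
    (n / s) ^ α * (s / n) ≤ 1 := by
  have hn : 0 < n := lt_of_lt_of_le hs hsn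
  have h1 : 1 ≤ n / s := by rw [le_div_iff₀ hs, one_mul]; exact hsn
  calc (n / s) ^ α * (s / n) ≤ (n / s) ^ (1 : ℝ) * (s / n) :=
        mul_le_mul_of_nonneg_right (Real.rpow_le_rpow_of_exponent_le h1 hα1) (div_nonneg hs.le hn.le)
    _ = 1 := by rw [Real.rpow_one, div_mul_div_comm, mul_comm, div_self (mul_pos hs hn).ne']

omit [Fintype ι] [DecidableEq ι] in
/-- for separations beyond one physical unit (`s ≥ n`) the Hölder weight is `≤ 1`. [folklore] -/
theorem holderWt_le_one {n s α : ℝ} (hn : 0 ≤ n) (hns : n ≤ s) (hs : 0 < s) (hα0 : 0 ≤ α) :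
    (n / s) ^ α ≤ 1 :=
  Real.rpow_le_one (div_nonneg hn hs.le) ((div_le_one hs).2 hns) hα0

omit [Fintype ι] [DecidableEq ι] in
/-- the Hölder weight is non-negative. [folklore] -/
theorem holderWt_nonneg {n s α : ℝ} (hn : 0 ≤ n) (hs : 0 ≤ s) : 0 ≤ (n / s) ^ α :=
  Real.rpow_nonneg (div_nonneg hn hs) _

end Flow

/-! ## §3 Generic pieces of the Hölder difference -/

section Pieces

variable {X Y : Type*} [Fintype X] [Fintype Y] [DecidableEq X]

omit [DecidableEq ι] [DecidableEq X] in
/-- `|v − w| ≤ |v| + |w|`. [folklore] -/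
theorem siteNorm_sub_le (v w : ι → ℝ) : siteNorm (v - w) ≤ siteNorm v + siteNorm w := by
  have h : siteNorm (-w) = siteNorm w := by
    rw [show -w = (-1 : ℝ) • w by simp, siteNorm_smul, abs_neg, abs_one, one_mul]
  rw [sub_eq_add_neg]
  exact (siteNorm_add_le v (-w)).trans (by rw [h])

omit [Fintype Y] [DecidableEq X] in
/-- THE ZERO-FIELD HÖLDER ROW ESTIMATE, VECTOR FORM: `|((S⊗1)Ψ)(y′) − ((S⊗1)Ψ)(y)| ≤ (Σ_z|S(y′,z) − S(y,z)|)·‖Ψ‖_∞`.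
[folklore] -/
theorem kron_dd_siteNorm_le (S : Matrix Y X ℝ) (Ψ : X × ι → ℝ) (y y' : Y) :
    siteNorm (fld ((S ⊗ₖ (1 : Matrix ι ι ℝ)) *ᵥ Ψ) y' - fld ((S ⊗ₖ (1 : Matrix ι ι ℝ)) *ᵥ Ψ) y)
      ≤ (∑ z, |S y' z - S y z|) * supN Ψ := by
  rw [fld_kron_mulVec, fld_kron_mulVec, ← Finset.sum_sub_distrib]
  simp_rw [← sub_smul]
  refine (siteNorm_sum_le _ _).trans ?_
  rw [Finset.sum_mul]
  refine Finset.sum_le_sum fun z _ => ?_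
  rw [siteNorm_smul]
  exact mul_le_mul_of_nonneg_left (le_supN Ψ z) (abs_nonneg _)

omit [Fintype X] [DecidableEq X] in
/-- `(g(x)g(x′)ᵀ)(g(x′)v) = g(x)v` for orthogonal `g`. [folklore] -/
theorem gauge_sandwich_mulVec {g : X → Matrix ι ι ℝ} (hg : IsGauge g) (x x' : X) (v : ι → ℝ) :
    (g x * (g x')ᵀ) *ᵥ (g x' *ᵥ v) = g x *ᵥ v := by
  rw [mulVec_mulVec, Matrix.mul_assoc, hg x', Matrix.mul_one]

omit [Fintype X] [DecidableEq X] in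
/-- `|g(x)g(x′)ᵀw| = |w|` for orthogonal `g`. [folklore] -/
theorem siteNorm_gauge_pair_mulVec {g : X → Matrix ι ι ℝ} (hg : IsGauge g) (x x' : X) (w : ι → ℝ) :
    siteNorm ((g x * (g x')ᵀ) *ᵥ w) = siteNorm w := by
  rw [← mulVec_mulVec, siteNorm_gauge_mulVec hg]
  exact siteNorm_gauge_mulVec (isGauge_transpose hg) x' w

end Pieces

/-! ## §4 Box pieces: the doubly differenced zero-field row, bond variations, the difference `D_Ã − D_{A₀}` sitewise -/

section BoxPieces

variable {d : ℕ}

omit [Fintype ι] [DecidableEq ι] in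
/-- FROM THE TREE'S TWO-CENTRE WEIGHTED ROW BOUND (`B4Thm19ZeroBoxHolder.thm19_zero_box_holder_roww`, weights
`≥ 1`) TO THE PLAIN HÖLDER ROW BOUND for the differenced kernel `D^η_μK`:
`ρ·Σ_z|(D^η_μK)(x′,z) − (D^η_μK)(x,z)| ≤ c₀`. [folklore] -/
theorem dd_row_le {N : Fin (d + 1) → ℕ} {n : ℕ} (K : Matrix ↥(boxDom N) ↥(boxDom N) ℝ) {μ : Fin (d + 1)}
    {x xe x' xe' : ↥(boxDom N)} (hxe : xe.1 = x.1 + e1 μ) (hxe' : xe'.1 = x'.1 + e1 μ) {ρ c₀ : ℝ}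
    (hρ : 0 ≤ ρ) (w : ↥(boxDom N) → ℝ) (hw : ∀ z, 1 ≤ w z)
    (h : ∑ z, |ρ * ((n : ℝ) * ((K xe' z - K x' z) - (K xe z - K x z)))| * w z ≤ c₀) :
    ρ * ∑ z, |(B4Cor23Zero.fdiffM n (boxDom N) μ * K) x' z - (B4Cor23Zero.fdiffM n (boxDom N) μ * K) x z|
      ≤ c₀ := by
  have hx : x.1 + Pi.single μ 1 ∈ boxDom N := by have h2 := xe.2; rw [hxe] at h2; exact h2
  have hx' : x'.1 + Pi.single μ 1 ∈ boxDom N := by have h2 := xe'.2; rw [hxe'] at h2; exact h2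
  have exe : (⟨x.1 + Pi.single μ 1, hx⟩ : ↥(boxDom N)) = xe := Subtype.ext (by rw [hxe]; rfl)
  have exe' : (⟨x'.1 + Pi.single μ 1, hx'⟩ : ↥(boxDom N)) = xe' := Subtype.ext (by rw [hxe']; rfl)
  have hrow : ∀ z, (B4Cor23Zero.fdiffM n (boxDom N) μ * K) x' z - (B4Cor23Zero.fdiffM n (boxDom N) μ * K) x z
      = (n : ℝ) * ((K xe' z - K x' z) - (K xe z - K x z)) := by
    intro z
    rw [fdiffM_mul_apply_of_mem K hx z, fdiffM_mul_apply_of_mem K hx' z, exe, exe']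
    ring
  simp_rw [hrow]
  rw [Finset.mul_sum]
  refine le_trans (Finset.sum_le_sum fun z _ => ?_) h
  rw [← abs_of_nonneg hρ, ← abs_mul, abs_of_nonneg hρ]
  exact le_mul_of_one_le_right (abs_nonneg _) (hw z)

variable {R : Finset (Fin (d + 1) → ℤ)}

/-- `D^η_{A₀,ν}` at a constant configuration on a forward bond: `(D^η_{A₀,ν}g)(y) = n·(U(κA₀,ν)g(y + e_ν) − g(y))`.
[cite: Balaban1983RegularityDecay, (1.3) p. 572] -/
theorem fld_derivConst_eq (F : OrthFlow ι) (κ : ℝ) (n : ℕ) (A₀ : Fin (d + 1) → ℝ) {ν : Fin (d + 1)}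
    (g : ↥R × ι → ℝ) {y ye : ↥R} (hye : ye.1 = y.1 + e1 ν) :
    fld (covDeriv n R (fieldLink F κ (constBond A₀ Subtype.val)) ν *ᵥ g) y
      = (n : ℝ) • (F.U (κ * A₀ ν) *ᵥ fld g ye - fld g y) := by
  obtain ⟨yev, hyev⟩ := ye
  simp only at hye
  subst hye
  rw [fld_covDeriv_mulVec_of_mem n _ g hyev]
  simp only [fieldLink]
  rw [constBond_fwd A₀ rfl]

/-- **THE VARIATION OF `g` OVER ONE BOND** in terms of its covariant derivative and its size:
`|g(y + e_ν) − g(y)| ≤ n^{-1}|(D^η_{A₀,ν}g)(y)| + ℓ|κA₀,ν|·|g(y + e_ν)|`. [folklore] -/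
theorem bond_variation_le (F : OrthFlow ι) {ℓ₁ : ℝ} (hℓ₁ : 0 ≤ ℓ₁)
    (hLip : ∀ t (v : ι → ℝ), ((F.U t - 1) *ᵥ v) ⬝ᵥ ((F.U t - 1) *ᵥ v) ≤ (ℓ₁ * t) ^ 2 * (v ⬝ᵥ v))
    (κ : ℝ) {n : ℕ} (hn : 1 ≤ n) (A₀ : Fin (d + 1) → ℝ) {ν : Fin (d + 1)} (g : ↥R × ι → ℝ) {y ye : ↥R}
    (hye : ye.1 = y.1 + e1 ν) :
    siteNorm (fld g ye - fld g y)
      ≤ (n : ℝ)⁻¹ * siteNorm (fld (covDeriv n R (fieldLink F κ (constBond A₀ Subtype.val)) ν *ᵥ g) y)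
        + ℓ₁ * |κ * A₀ ν| * siteNorm (fld g ye) := by
  have hn0 : (0 : ℝ) < n := by exact_mod_cast hn
  rw [fld_derivConst_eq F κ n A₀ g hye, siteNorm_smul, abs_of_pos hn0, ← mul_assoc, inv_mul_cancel₀ hn0.ne',
    one_mul]
  have hsplit : fld g ye - fld g y
      = (F.U (κ * A₀ ν) *ᵥ fld g ye - fld g y) - (F.U (κ * A₀ ν) - 1) *ᵥ fld g ye := by
    rw [sub_mulVec, one_mulVec]; abel
  rw [hsplit]
  exact (siteNorm_sub_le _ _).trans
    (add_le_add le_rfl (siteNorm_flow_sub_one_le F hℓ₁ hLip _ _))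

/-- **`(D^η_{Ã,μ} − D^η_{A₀,μ})g` AT A SITE WITH ITS FORWARD BOND IN THE REGION**:
`= n·(U(κA′(y,y+e_μ)) − 1)·U(κA₀,μ)·g(y+e_μ)` (`B4Lemma22ReduceDeriv.covDeriv_sub_fld_of_mem` at a constant
`A₀`). [cite: Balaban1983RegularityDecay, p. 580 «D^η_A = U(A')D^η_{A₀} + F_{1,k}(A')»] -/
theorem fld_covDeriv_sub_eq (F : OrthFlow ι) (κ : ℝ) (n : ℕ) (A₀ : Fin (d + 1) → ℝ) (A' : ↥R → ↥R → ℝ)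
    {μ : Fin (d + 1)} (g : ↥R × ι → ℝ) {y ye : ↥R} (hye : ye.1 = y.1 + e1 μ) :
    fld ((covDeriv n R (fieldLink F κ (constBond A₀ Subtype.val + A')) μ
        - covDeriv n R (fieldLink F κ (constBond A₀ Subtype.val)) μ) *ᵥ g) y
      = (n : ℝ) • ((F.U (κ * A' y ye) - 1) *ᵥ (F.U (κ * A₀ μ) *ᵥ fld g ye)) := by
  obtain ⟨yev, hyev⟩ := ye
  simp only at hye
  subst hye
  rw [covDeriv_sub_fld_of_mem F κ n (constBond A₀ Subtype.val) A' g hyev]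
  simp only [fieldLink]
  rw [constBond_fwd A₀ rfl]

end BoxPieces

/-! ## §5 THE KEY ESTIMATE: the transported `D_Ã`-Hölder quotient of `G_k(□,A₀)Φ` -/

section Key

variable {d : ℕ}

open Literature.MathematicalPhysics.QuantumFieldTheory.Balaban1983to89.B4BoxCov237 (boxOpR boxOpR_det_isUnit)
open Literature.MathematicalPhysics.QuantumFieldTheory.Balaban1983to89.B4Thm19ZeroBoxHolder
  (thm19_zero_box_holder_roww)

set_option maxHeartbeats 400000 in
/-- **THE KEY ESTIMATE.**  For the constant-configuration propagator `g = G_k(□,A₀)Φ` on a fine box, the HÖLDER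
QUOTIENT OF (2.14) FORMED WITH THE FULL FIELD `Ã = A₀ + A′` — covariant derivative `D^η_{Ã,μ}` and parallel
transport `U(Ã(Γ_{x,x′}))` along any nearest-neighbour contour `Γ_{x,x′}` of length `≤ (d+1)|x − x′|_∞` (every
shortest contour qualifies) — is bounded by `c₁‖Φ‖_∞`, uniformly in `k` (i.e. in `η = L^{-k}`), the box, the contour
system of the averaging operators, `A₀`, `A′`, provided `|κA₀,ν|, |κA′_b| ≤ θ/n` (size, (1.7)/(2.23) in lattice units)
and `|κ(A′(x′,x′+e_μ) − A′(x,x+e_μ))| ≤ θ′|x′−x|_∞/n²` (the derivative bound of a regular configuration in lattice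
units), `θ, θ′ ≤ 1`.  Ingredients: the zero-field Hölder row bound (1.9) of the tree
(`B4Thm19ZeroBoxHolder.thm19_zero_box_holder_roww`), the gauge step `A₀ ⇒ 0`
(`B4GaugeCovariance.b4Green_constBond`, `transport_constBond`), the constant-`A₀` sup bounds
(`B4Lemma22ReduceZero.const_box_sup`) and the sitewise form of `D_Ã − D_{A₀}`.
[cite: Balaban1983RegularityDecay, (2.14), Lemma 2.2 (2.16) pp. 577–578; proof p. 581 (2.33)] -/
theorem holder_const_green (F : OrthFlow ι) {ℓ₁ : ℝ} (hℓ₁ : 0 ≤ ℓ₁)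
    (hLip : ∀ t (v : ι → ℝ), ((F.U t - 1) *ᵥ v) ⬝ᵥ ((F.U t - 1) *ᵥ v) ≤ (ℓ₁ * t) ^ 2 * (v ⬝ᵥ v))
    (κ : ℝ) (d ℓ : ℕ) (hℓ : 1 ≤ ℓ) (amin aplus m2plus : ℝ) (ha : 0 < amin) (α : ℝ) (hα0 : 0 ≤ α)
    (hα1 : α < 1) :
    ∃ c₁ : ℝ, 0 < c₁ ∧ ∀ (k : ℕ), 1 ≤ k → ∀ (a m2 : ℝ), amin ≤ a → a ≤ aplus → 0 ≤ m2 → m2 ≤ m2plus →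
      ∀ (M : Fin (d + 1) → ℕ), (∀ i, 1 ≤ M i) →
      ∀ (emb : ↥(boxDom M) → ↥(Box d ℓ k M)) (Γ : ↥(boxDom M) → ↥(Box d ℓ k M) → List ↥(Box d ℓ k M)),
        (∀ y x, blkWt ((ℓ + 1) ^ k) M (fun i => (ℓ + 1) ^ k * M i) y x ≠ 0 → pathEnd (emb y) (Γ y x) = x) →
      ∀ (A₀ : Fin (d + 1) → ℝ) (A' : ↥(Box d ℓ k M) → ↥(Box d ℓ k M) → ℝ) (θ θ' : ℝ),
        0 ≤ θ → θ ≤ 1 → 0 ≤ θ' → θ' ≤ 1 →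
        (∀ ν, |κ * A₀ ν| ≤ θ / ((ℓ + 1) ^ k : ℕ)) →
        (∀ x y : ↥(Box d ℓ k M), y.1 ∈ nbrs x.1 → |κ * A' x y| ≤ θ / ((ℓ + 1) ^ k : ℕ)) →
        (∀ (μ : Fin (d + 1)) (x xe x' xe' : ↥(Box d ℓ k M)), xe.1 = x.1 + e1 μ → xe'.1 = x'.1 + e1 μ →
          |κ * (A' x' xe' - A' x xe)|
            ≤ θ' * supNorm (x'.1 - x.1) / (((ℓ + 1) ^ k : ℕ) : ℝ) ^ 2) →
      ∀ (μ : Fin (d + 1)) (x xe x' xe' : ↥(Box d ℓ k M)),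
        xe.1 = x.1 + e1 μ → xe'.1 = x'.1 + e1 μ → x'.1 ≠ x.1 →
      ∀ (l : List ↥(Box d ℓ k M)), IsNNChain x l → pathEnd x l = x' →
        (l.length : ℝ) ≤ ((d : ℝ) + 1) * supNorm (x'.1 - x.1) →
      ∀ Φ : ↥(Box d ℓ k M) × ι → ℝ,
        ((((ℓ + 1) ^ k : ℕ) : ℝ) / supNorm (x'.1 - x.1)) ^ α *
          siteNorm (transport (fieldLink F κ (constBond A₀ Subtype.val + A')) x l
              *ᵥ fld (derivA d F κ ℓ k M (constBond A₀ Subtype.val + A') μ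
                    *ᵥ (greenA0 d F κ ℓ k a m2 M emb Γ A₀ *ᵥ Φ)) x'
            - fld (derivA d F κ ℓ k M (constBond A₀ Subtype.val + A') μ
                    *ᵥ (greenA0 d F κ ℓ k a m2 M emb Γ A₀ *ᵥ Φ)) x)
          ≤ c₁ * supN Φ := by
  obtain ⟨c, hc, hCS⟩ := const_box_sup F κ d ℓ hℓ amin aplus m2plus ha
  obtain ⟨δ₀, cH, hδ, hcH, hH⟩ := thm19_zero_box_holder_roww d ℓ hℓ amin aplus m2plus ha α hα0 hα1
  refine ⟨cH + 3 * ((d : ℝ) + 3) * (1 + ℓ₁) ^ 2 * c, by positivity, ?_⟩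
  intro k hk a m2 e1' e2 e3 e4 M hM emb Γ hend A₀ A' θ θ' hθ hθ1 hθ' hθ'1 hA0 hA' hA'' μ x xe x' xe' hxe hxe'
    hne l hl hlend hlen Φ
  obtain ⟨h0, hD⟩ := hCS k hk a m2 e1' e2 e3 e4 M hM emb Γ hend A₀
  -- numbers
  have hn1 : 1 ≤ (ℓ + 1) ^ k := Nat.one_le_pow _ _ (Nat.succ_pos ℓ)
  set n : ℝ := (((ℓ + 1) ^ k : ℕ) : ℝ) with hn_def
  have hn : (1 : ℝ) ≤ n := by rw [hn_def]; exact_mod_cast hn1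
  have hn0 : (0 : ℝ) < n := lt_of_lt_of_le one_pos hn
  set s : ℝ := supNorm (x'.1 - x.1) with hs_def
  have hs1 : 1 ≤ s := one_le_supNorm (sub_ne_zero.2 hne)
  have hs0 : 0 < s := lt_of_lt_of_le one_pos hs1
  set ρ : ℝ := (n / s) ^ α with hρ_def
  have hρ : 0 ≤ ρ := holderWt_nonneg hn0.le hs0.le
  have hlen0 : (0 : ℝ) ≤ l.length := Nat.cast_nonneg _
  have hXΦ : 0 ≤ c * supN Φ := mul_nonneg hc.le (supN_nonneg Φ)
  -- the objects
  set g : ↥(Box d ℓ k M) × ι → ℝ := greenA0 d F κ ℓ k a m2 M emb Γ A₀ *ᵥ Φ with hg_def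
  set ψ₀ : ↥(Box d ℓ k M) × ι → ℝ := derivA0 d F κ ℓ k M A₀ μ *ᵥ g with hψ₀_def
  set E : ↥(Box d ℓ k M) × ι → ℝ :=
    (derivA d F κ ℓ k M (constBond A₀ Subtype.val + A') μ - derivA0 d F κ ℓ k M A₀ μ) *ᵥ g with hE_def
  have hψ : derivA d F κ ℓ k M (constBond A₀ Subtype.val + A') μ *ᵥ g = ψ₀ + E := by
    rw [hψ₀_def, hE_def, sub_mulVec]; abel
  -- sup bounds (2.17)_∞ at the constant configuration and the conversion bound
  have hg0 : supN g ≤ c * supN Φ := h0 Φ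
  have hD0 : ∀ ν, supN (derivA0 d F κ ℓ k M A₀ ν *ᵥ g) ≤ c * supN Φ := fun ν => hD ν Φ
  have hψ₀sup : supN ψ₀ ≤ c * supN Φ := hD0 μ
  have hEsup : supN E ≤ ℓ₁ * θ * (c * supN Φ) :=
    (covDeriv_sub_supN_le_nbrs F hℓ₁ hLip κ hn1 (constBond A₀ Subtype.val) hθ hA' μ g).trans
      (mul_le_mul_of_nonneg_left hg0 (mul_nonneg hℓ₁ hθ))
  -- the gauge function of the constant configuration and the transports
  set gA : ↥(Box d ℓ k M) → Matrix ι ι ℝ := fun u => F.U (κ * linGauge A₀ Subtype.val u) with hgA_def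
  have hg : IsGauge gA := F.isGauge _
  have hT0 : transport (fieldLink F κ (constBond A₀ Subtype.val)) x l = gA x * (gA x')ᵀ := by
    rw [transport_constBond, hlend]
  have hT : transport (fieldLink F κ (constBond A₀ Subtype.val + A')) x l
      = gA x * (gA x')ᵀ * F.U (κ * pathSum A' x l) := by
    rw [transport_fieldLink, pathSum_add, mul_add, F.map_add, ← transport_fieldLink F κ _ x l, hT0]
  have hT' : transport (fieldLink F κ (constBond A₀ Subtype.val + A')) x l
      = F.U (κ * pathSum (constBond A₀ Subtype.val + A') x l) := transport_fieldLink F κ _ x l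
  have hT0iso : ∀ w, siteNorm ((gA x * (gA x')ᵀ) *ᵥ w) = siteNorm w := siteNorm_gauge_pair_mulVec hg x x'
  -- bond sums along the chain
  have hS' : |κ * pathSum A' x l| ≤ l.length * (θ / n) := abs_pathSum_le hA' x l hl
  have hbÃ : ∀ u v : ↥(Box d ℓ k M), v.1 ∈ nbrs u.1 →
      |κ * ((constBond A₀ Subtype.val + A' : ↥(Box d ℓ k M) → ↥(Box d ℓ k M) → ℝ) u v)| ≤ θ / n + θ / n := by
    intro u v huv
    rw [Pi.add_apply, Pi.add_apply, mul_add]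
    exact (abs_add_le _ _).trans (add_le_add (constBond_nbrs_abs_le A₀ hA0 huv) (hA' u v huv))
  have hSÃ : |κ * pathSum (constBond A₀ Subtype.val + A') x l| ≤ l.length * (θ / n + θ / n) :=
    abs_pathSum_le hbÃ x l hl
  -- CASE SPLIT on the separation: beyond one physical unit the weight is ≤ 1 and the sup bounds suffice
  by_cases hsn : n < s
  · have hρ1 : ρ ≤ 1 := holderWt_le_one hn0.le hsn.le hs0 hα0
    have hv : ∀ y, siteNorm (fld (ψ₀ + E) y) ≤ (1 + ℓ₁ * θ) * (c * supN Φ) := by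
      intro y
      refine (le_supN _ y).trans ((supN_add_le _ _).trans ?_)
      calc supN ψ₀ + supN E ≤ c * supN Φ + ℓ₁ * θ * (c * supN Φ) := add_le_add hψ₀sup hEsup
        _ = (1 + ℓ₁ * θ) * (c * supN Φ) := by ring
    rw [hψ, hT']
    calc ρ * siteNorm (F.U (κ * pathSum (constBond A₀ Subtype.val + A') x l) *ᵥ fld (ψ₀ + E) x'
              - fld (ψ₀ + E) x)
          ≤ 1 * ((1 + ℓ₁ * θ) * (c * supN Φ) + (1 + ℓ₁ * θ) * (c * supN Φ)) := by
            refine mul_le_mul hρ1 ((siteNorm_sub_le _ _).trans (add_le_add ?_ (hv x))) (siteNorm_nonneg _)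
              zero_le_one
            rw [siteNorm_flow]
            exact hv x'
      _ ≤ (cH + 3 * ((d : ℝ) + 3) * (1 + ℓ₁) ^ 2 * c) * supN Φ := by
            have h1 : (1 + ℓ₁ * θ) ≤ 1 + ℓ₁ := by
              have := mul_le_mul_of_nonneg_left hθ1 hℓ₁
              linarith
            have h2 : 0 ≤ cH * supN Φ := mul_nonneg hcH.le (supN_nonneg Φ)
            have h3 : 2 * (1 + ℓ₁) ≤ 3 * ((d : ℝ) + 3) * (1 + ℓ₁) ^ 2 := by
              have hd : (0 : ℝ) ≤ d := Nat.cast_nonneg d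
              have hdq : 0 ≤ (d : ℝ) * (1 + ℓ₁) ^ 2 := mul_nonneg hd (sq_nonneg _)
              linarith [sq_nonneg ℓ₁]
            linarith [mul_le_mul_of_nonneg_right h1 hXΦ, mul_le_mul_of_nonneg_right h3 hXΦ]
  -- MAIN CASE `s ≤ n`
  push Not at hsn
  have hr : ρ * (s / n) ≤ 1 := holderWt_mul_ratio_le_one hs0 hsn hα1.le
  have hr0 : 0 ≤ s / n := div_nonneg hs0.le hn0.le
  have hlen' : (l.length : ℝ) / n ≤ ((d : ℝ) + 1) * (s / n) := by
    rw [mul_div_assoc']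
    exact div_le_div_of_nonneg_right hlen hn0.le
  -- (i-b) THE ZERO-FIELD HÖLDER ROW BOUND, transported through the gauge `A₀ ⇒ 0`
  have hL : (1 : ℝ) < (ℓ : ℝ) + 1 := by
    have : (1 : ℝ) ≤ (ℓ : ℝ) := by exact_mod_cast hℓ
    linarith
  have hak : 0 < B1.aSeq a ((ℓ : ℝ) + 1) k := B1.aSeq_pos (lt_of_lt_of_le ha e1') hL hk
  have hS : IsUnit (scalarOp (boxWt ((ℓ + 1) ^ k) (fun i => (ℓ + 1) ^ k * M i)) m2
      (B1.aSeq a ((ℓ : ℝ) + 1) k * (((((ℓ + 1) ^ k : ℕ)) : ℝ) ^ (d + 1))⁻¹)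
      (blkWt ((ℓ + 1) ^ k) M (fun i => (ℓ + 1) ^ k * M i))).det := by
    rw [scalarOp_box hn1]
    exact boxOpR_det_isUnit hn1 hak e3 hM
  have hG : greenA0 d F κ ℓ k a m2 M emb Γ A₀
      = blockDiag gA * (gk d ℓ k a m2 M ⊗ₖ (1 : Matrix ι ι ℝ)) * (blockDiag gA)ᵀ := by
    dsimp only [greenA0]
    rw [b4Green_constBond F κ _ m2 _ hend A₀ _ hS, scalarOp_box hn1]
  have hDer : derivA0 d F κ ℓ k M A₀ μ
      = blockDiag gA * (dk d ℓ k M μ ⊗ₖ (1 : Matrix ι ι ℝ)) * (blockDiag gA)ᵀ := by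
    dsimp only [derivA0]
    rw [covDeriv_constBond]
  set Φt : ↥(Box d ℓ k M) × ι → ℝ := (blockDiag gA)ᵀ *ᵥ Φ with hΦt_def
  set w : ↥(Box d ℓ k M) × ι → ℝ :=
    ((dk d ℓ k M μ * gk d ℓ k a m2 M) ⊗ₖ (1 : Matrix ι ι ℝ)) *ᵥ Φt with hw_def
  have hψ₀w : ψ₀ = blockDiag gA *ᵥ w := by
    rw [hψ₀_def, hg_def, mulVec_mulVec, hDer, hG, conj_mul_conj hg, ← mulVec_mulVec, ← mulVec_mulVec,
      ← mulVec_mulVec, kron_mulVec_kron_mulVec]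
  have hΦt : supN Φt = supN Φ := supN_gauge_transpose hg Φ
  have hib_eq : (gA x * (gA x')ᵀ) *ᵥ fld ψ₀ x' - fld ψ₀ x = gA x *ᵥ (fld w x' - fld w x) := by
    rw [hψ₀w, fld_blockDiag_mulVec, fld_blockDiag_mulVec, gauge_sandwich_mulVec hg, mulVec_sub]
  have hib : ρ * siteNorm ((gA x * (gA x')ᵀ) *ᵥ fld ψ₀ x' - fld ψ₀ x) ≤ cH * supN Φ := by
    rw [hib_eq, siteNorm_gauge_mulVec hg]
    have hrow := dd_row_le (gk d ℓ k a m2 M) hxe hxe' hρ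
      (fun z => Real.exp (δ₀ * min (supNorm (x.1 - z.1)) (supNorm (x'.1 - z.1)) / n))
      (fun z => Real.one_le_exp (div_nonneg (mul_nonneg hδ.le
        (le_min (supNorm_nonneg _) (supNorm_nonneg _))) hn0.le))
      (hH k hk a m2 e1' e2 e3 e4 M hM μ x xe x' xe' hxe hxe' hne)
    calc ρ * siteNorm (fld w x' - fld w x)
        ≤ ρ * ((∑ z, |(dk d ℓ k M μ * gk d ℓ k a m2 M) x' z - (dk d ℓ k M μ * gk d ℓ k a m2 M) x z|)
            * supN Φt) := mul_le_mul_of_nonneg_left (kron_dd_siteNorm_le _ Φt x x') hρ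
      _ = (ρ * ∑ z, |(dk d ℓ k M μ * gk d ℓ k a m2 M) x' z - (dk d ℓ k M μ * gk d ℓ k a m2 M) x z|)
            * supN Φ := by rw [hΦt, mul_assoc]
      _ ≤ cH * supN Φ := mul_le_mul_of_nonneg_right hrow (supN_nonneg Φ)
  -- (i-a) the `A′`-part of the transport acting on `ψ₀(x′)`
  have hia : siteNorm ((gA x * (gA x')ᵀ * F.U (κ * pathSum A' x l)) *ᵥ fld ψ₀ x'
        - (gA x * (gA x')ᵀ) *ᵥ fld ψ₀ x')
      ≤ (ℓ₁ * θ * ((d : ℝ) + 1)) * (s / n) * (c * supN Φ) := by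
    refine (siteNorm_flow_mul_sub_le F hℓ₁ hLip _ hT0iso _ _).trans ?_
    have h1 : |κ * pathSum A' x l| ≤ ((d : ℝ) + 1) * (s / n) * θ := by
      refine hS'.trans ?_
      rw [show (l.length : ℝ) * (θ / n) = (l.length : ℝ) / n * θ by ring]
      exact mul_le_mul_of_nonneg_right hlen' hθ
    have h2 : siteNorm (fld ψ₀ x') ≤ c * supN Φ := (le_supN ψ₀ x').trans hψ₀sup
    calc ℓ₁ * |κ * pathSum A' x l| * siteNorm (fld ψ₀ x')
        ≤ ℓ₁ * (((d : ℝ) + 1) * (s / n) * θ) * (c * supN Φ) :=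
          mul_le_mul (mul_le_mul_of_nonneg_left h1 hℓ₁) h2 (siteNorm_nonneg _)
            (mul_nonneg hℓ₁ (by positivity))
      _ = (ℓ₁ * θ * ((d : ℝ) + 1)) * (s / n) * (c * supN Φ) := by ring
  -- (ii-a) the transport acting on `E(x′)`
  have hiia : siteNorm (F.U (κ * pathSum (constBond A₀ Subtype.val + A') x l) *ᵥ fld E x' - fld E x')
      ≤ (2 * ((d : ℝ) + 1) * ℓ₁ ^ 2 * θ ^ 2) * (s / n) * (c * supN Φ) := by
    rw [show F.U (κ * pathSum (constBond A₀ Subtype.val + A') x l) *ᵥ fld E x' - fld E x'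
        = (F.U (κ * pathSum (constBond A₀ Subtype.val + A') x l) - 1) *ᵥ fld E x' by
          rw [sub_mulVec, one_mulVec]]
    refine (siteNorm_flow_sub_one_le F hℓ₁ hLip _ _).trans ?_
    have h1 : |κ * pathSum (constBond A₀ Subtype.val + A') x l| ≤ 2 * ((d : ℝ) + 1) * (s / n) * θ := by
      refine hSÃ.trans ?_
      rw [show (l.length : ℝ) * (θ / n + θ / n) = 2 * ((l.length : ℝ) / n) * θ by ring,
        show 2 * ((d : ℝ) + 1) * (s / n) * θ = 2 * (((d : ℝ) + 1) * (s / n)) * θ by ring]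
      exact mul_le_mul_of_nonneg_right (mul_le_mul_of_nonneg_left hlen' zero_le_two) hθ
    have h2 : siteNorm (fld E x') ≤ ℓ₁ * θ * (c * supN Φ) := (le_supN E x').trans hEsup
    calc ℓ₁ * |κ * pathSum (constBond A₀ Subtype.val + A') x l| * siteNorm (fld E x')
        ≤ ℓ₁ * (2 * ((d : ℝ) + 1) * (s / n) * θ) * (ℓ₁ * θ * (c * supN Φ)) :=
          mul_le_mul (mul_le_mul_of_nonneg_left h1 hℓ₁) h2 (siteNorm_nonneg _)
            (mul_nonneg hℓ₁ (by positivity))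
      _ = (2 * ((d : ℝ) + 1) * ℓ₁ ^ 2 * θ ^ 2) * (s / n) * (c * supN Φ) := by ring
  -- (ii-b) the variation of `E` itself between `x` and `x′`
  have hB : ∀ (ν : Fin (d + 1)) (y ye : ↥(Box d ℓ k M)), ye.1 = y.1 + e1 ν →
      siteNorm (fld g ye - fld g y) ≤ (1 + ℓ₁ * θ) * (c * supN Φ) / n := by
    intro ν y ye hye
    refine (bond_variation_le F hℓ₁ hLip κ hn1 A₀ g hye).trans ?_
    have h1 : siteNorm (fld (covDeriv ((ℓ + 1) ^ k) (Box d ℓ k M)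
        (fieldLink F κ (constBond A₀ Subtype.val)) ν *ᵥ g) y) ≤ c * supN Φ :=
      (le_supN _ y).trans (hD0 ν)
    have h2 : siteNorm (fld g ye) ≤ c * supN Φ := (le_supN g ye).trans hg0
    have h3 : ℓ₁ * |κ * A₀ ν| ≤ ℓ₁ * (θ / n) := mul_le_mul_of_nonneg_left (hA0 ν) hℓ₁
    calc (n : ℝ)⁻¹ * siteNorm (fld (covDeriv ((ℓ + 1) ^ k) (Box d ℓ k M)
              (fieldLink F κ (constBond A₀ Subtype.val)) ν *ᵥ g) y) + ℓ₁ * |κ * A₀ ν| * siteNorm (fld g ye)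
        ≤ (n : ℝ)⁻¹ * (c * supN Φ) + ℓ₁ * (θ / n) * (c * supN Φ) :=
          add_le_add (mul_le_mul_of_nonneg_left h1 (inv_nonneg.2 hn0.le))
            (mul_le_mul h3 h2 (siteNorm_nonneg _) (mul_nonneg hℓ₁ (div_nonneg hθ hn0.le)))
      _ = (1 + ℓ₁ * θ) * (c * supN Φ) / n := by
          field_simp
  have hV : siteNorm (fld g xe' - fld g xe) ≤ ((d : ℝ) + 3) * s * ((1 + ℓ₁ * θ) * (c * supN Φ) / n) := by
    have hB0 : 0 ≤ (1 + ℓ₁ * θ) * (c * supN Φ) / n := by positivity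
    have e3' : fld g xe' - fld g xe
        = (fld g xe' - fld g x') + (fld g (pathEnd x l) - fld g x) + (fld g x - fld g xe) := by
      rw [hlend]; abel
    rw [e3']
    have t1 := hB μ x' xe' hxe'
    have t2 := chain_variation_le g hB x l hl
    have t3 : siteNorm (fld g x - fld g xe) ≤ (1 + ℓ₁ * θ) * (c * supN Φ) / n := by
      rw [← neg_sub, show -(fld g xe - fld g x) = (-1 : ℝ) • (fld g xe - fld g x) by simp, siteNorm_smul,
        abs_neg, abs_one, one_mul]
      exact hB μ x xe hxe
    calc siteNorm (fld g xe' - fld g x' + (fld g (pathEnd x l) - fld g x) + (fld g x - fld g xe))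
        ≤ siteNorm (fld g xe' - fld g x' + (fld g (pathEnd x l) - fld g x)) + siteNorm (fld g x - fld g xe) :=
          siteNorm_add_le _ _
      _ ≤ (siteNorm (fld g xe' - fld g x') + siteNorm (fld g (pathEnd x l) - fld g x))
            + siteNorm (fld g x - fld g xe) := add_le_add (siteNorm_add_le _ _) le_rfl
      _ ≤ ((1 + ℓ₁ * θ) * (c * supN Φ) / n + l.length * ((1 + ℓ₁ * θ) * (c * supN Φ) / n))
            + (1 + ℓ₁ * θ) * (c * supN Φ) / n := add_le_add (add_le_add t1 t2) t3
      _ = ((l.length : ℝ) + 2) * ((1 + ℓ₁ * θ) * (c * supN Φ) / n) := by ring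
      _ ≤ ((d : ℝ) + 3) * s * ((1 + ℓ₁ * θ) * (c * supN Φ) / n) := by
          refine mul_le_mul_of_nonneg_right ?_ hB0
          linarith
  have hiib : siteNorm (fld E x' - fld E x)
      ≤ (ℓ₁ * θ' + ℓ₁ * θ * ((d : ℝ) + 3) * (1 + ℓ₁ * θ)) * (s / n) * (c * supN Φ) := by
    have eE' : fld E x' = (n : ℝ) • ((F.U (κ * A' x' xe') - 1) *ᵥ (F.U (κ * A₀ μ) *ᵥ fld g xe')) :=
      fld_covDeriv_sub_eq F κ _ A₀ A' g hxe'
    have eE : fld E x = (n : ℝ) • ((F.U (κ * A' x xe) - 1) *ᵥ (F.U (κ * A₀ μ) *ᵥ fld g xe)) :=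
      fld_covDeriv_sub_eq F κ _ A₀ A' g hxe
    have esplit : fld E x' - fld E x
        = (n : ℝ) • ((F.U (κ * A' x' xe') - F.U (κ * A' x xe)) *ᵥ (F.U (κ * A₀ μ) *ᵥ fld g xe')
            + (F.U (κ * A' x xe) - 1) *ᵥ (F.U (κ * A₀ μ) *ᵥ (fld g xe' - fld g xe))) := by
      rw [eE', eE, ← smul_sub]
      congr 1
      simp only [sub_mulVec, one_mulVec, mulVec_sub]
      abel
    rw [esplit, siteNorm_smul, abs_of_pos hn0]
    have p1 : siteNorm ((F.U (κ * A' x' xe') - F.U (κ * A' x xe)) *ᵥ (F.U (κ * A₀ μ) *ᵥ fld g xe'))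
        ≤ ℓ₁ * (θ' * s / n ^ 2) * (c * supN Φ) := by
      refine (siteNorm_flow_sub_flow_le F hℓ₁ hLip _ _ _).trans ?_
      rw [siteNorm_flow, ← mul_sub]
      exact mul_le_mul (mul_le_mul_of_nonneg_left (hA'' μ x xe x' xe' hxe hxe') hℓ₁)
        ((le_supN g xe').trans hg0) (siteNorm_nonneg _) (mul_nonneg hℓ₁ (by positivity))
    have p2 : siteNorm ((F.U (κ * A' x xe) - 1) *ᵥ (F.U (κ * A₀ μ) *ᵥ (fld g xe' - fld g xe)))
        ≤ ℓ₁ * (θ / n) * (((d : ℝ) + 3) * s * ((1 + ℓ₁ * θ) * (c * supN Φ) / n)) := by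
      refine (siteNorm_flow_sub_one_le F hℓ₁ hLip _ _).trans ?_
      rw [siteNorm_flow]
      exact mul_le_mul (mul_le_mul_of_nonneg_left (hA' x xe (hxe ▸ add_e1_mem_nbrs x.1 μ)) hℓ₁) hV
        (siteNorm_nonneg _) (mul_nonneg hℓ₁ (div_nonneg hθ hn0.le))
    calc (n : ℝ) * siteNorm ((F.U (κ * A' x' xe') - F.U (κ * A' x xe)) *ᵥ (F.U (κ * A₀ μ) *ᵥ fld g xe')
              + (F.U (κ * A' x xe) - 1) *ᵥ (F.U (κ * A₀ μ) *ᵥ (fld g xe' - fld g xe)))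
        ≤ (n : ℝ) * (ℓ₁ * (θ' * s / n ^ 2) * (c * supN Φ)
              + ℓ₁ * (θ / n) * (((d : ℝ) + 3) * s * ((1 + ℓ₁ * θ) * (c * supN Φ) / n))) :=
          mul_le_mul_of_nonneg_left ((siteNorm_add_le _ _).trans (add_le_add p1 p2)) hn0.le
      _ = (ℓ₁ * θ' + ℓ₁ * θ * ((d : ℝ) + 3) * (1 + ℓ₁ * θ)) * (s / n) * (c * supN Φ) := by
          field_simp
  -- ASSEMBLY
  have htot_eq : transport (fieldLink F κ (constBond A₀ Subtype.val + A')) x l *ᵥ fld (ψ₀ + E) x'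
        - fld (ψ₀ + E) x
      = ((gA x * (gA x')ᵀ) *ᵥ fld ψ₀ x' - fld ψ₀ x)
        + ((gA x * (gA x')ᵀ * F.U (κ * pathSum A' x l)) *ᵥ fld ψ₀ x' - (gA x * (gA x')ᵀ) *ᵥ fld ψ₀ x')
        + (F.U (κ * pathSum (constBond A₀ Subtype.val + A') x l) *ᵥ fld E x' - fld E x')
        + (fld E x' - fld E x) := by
    have e1 : transport (fieldLink F κ (constBond A₀ Subtype.val + A')) x l *ᵥ fld (ψ₀ + E) x'
        = (gA x * (gA x')ᵀ * F.U (κ * pathSum A' x l)) *ᵥ fld ψ₀ x'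
          + F.U (κ * pathSum (constBond A₀ Subtype.val + A') x l) *ᵥ fld E x' := by
      rw [fld_add, mulVec_add]
      congr 1
      · rw [hT]
      · rw [hT']
    rw [e1, fld_add]
    abel
  set K₁ : ℝ := ℓ₁ * θ * ((d : ℝ) + 1)
  set K₂ : ℝ := 2 * ((d : ℝ) + 1) * ℓ₁ ^ 2 * θ ^ 2
  set K₃ : ℝ := ℓ₁ * θ' + ℓ₁ * θ * ((d : ℝ) + 3) * (1 + ℓ₁ * θ)
  have hK0 : 0 ≤ K₁ + K₂ + K₃ := by positivity
  have hK : K₁ + K₂ + K₃ ≤ 3 * ((d : ℝ) + 3) * (1 + ℓ₁) ^ 2 := by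
    have hd : (0 : ℝ) ≤ d := Nat.cast_nonneg d
    have b2 : ℓ₁ * θ ≤ ℓ₁ := by
      have := mul_le_mul_of_nonneg_left hθ1 hℓ₁
      linarith
    have a1 : K₁ ≤ ((d : ℝ) + 3) * ℓ₁ := by
      have := mul_le_mul_of_nonneg_right b2 (by positivity : (0 : ℝ) ≤ (d : ℝ) + 1)
      linarith
    have a2 : K₂ ≤ 2 * ((d : ℝ) + 3) * ℓ₁ ^ 2 := by
      have hθ2 : θ ^ 2 ≤ 1 := pow_le_one₀ hθ hθ1
      have h' : ℓ₁ ^ 2 * θ ^ 2 ≤ ℓ₁ ^ 2 := mul_le_of_le_one_right (sq_nonneg _) hθ2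
      have := mul_le_mul_of_nonneg_left h' (by positivity : (0 : ℝ) ≤ 2 * ((d : ℝ) + 1))
      linarith [sq_nonneg ℓ₁]
    have a3 : K₃ ≤ ℓ₁ + ((d : ℝ) + 3) * (ℓ₁ + ℓ₁ ^ 2) := by
      have b1 : ℓ₁ * θ' ≤ ℓ₁ := by
        have := mul_le_mul_of_nonneg_left hθ'1 hℓ₁
        linarith
      have b3 : ℓ₁ * θ * ((d : ℝ) + 3) * (1 + ℓ₁ * θ) ≤ ℓ₁ * ((d : ℝ) + 3) * (1 + ℓ₁) := by
        have : 0 ≤ ℓ₁ * θ := mul_nonneg hℓ₁ hθ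
        have : (1 + ℓ₁ * θ) ≤ 1 + ℓ₁ := by linarith
        calc ℓ₁ * θ * ((d : ℝ) + 3) * (1 + ℓ₁ * θ) ≤ ℓ₁ * ((d : ℝ) + 3) * (1 + ℓ₁ * θ) :=
              mul_le_mul_of_nonneg_right (mul_le_mul_of_nonneg_right b2 (by positivity)) (by positivity)
          _ ≤ ℓ₁ * ((d : ℝ) + 3) * (1 + ℓ₁) := by
              exact mul_le_mul_of_nonneg_left this (by positivity)
      linarith
    have hdl : 0 ≤ (d : ℝ) * ℓ₁ := mul_nonneg hd hℓ₁
    linarith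
  rw [hψ, htot_eq]
  calc ρ * siteNorm ((gA x * (gA x')ᵀ) *ᵥ fld ψ₀ x' - fld ψ₀ x
          + ((gA x * (gA x')ᵀ * F.U (κ * pathSum A' x l)) *ᵥ fld ψ₀ x' - (gA x * (gA x')ᵀ) *ᵥ fld ψ₀ x')
          + (F.U (κ * pathSum (constBond A₀ Subtype.val + A') x l) *ᵥ fld E x' - fld E x')
          + (fld E x' - fld E x))
      ≤ ρ * (((siteNorm ((gA x * (gA x')ᵀ) *ᵥ fld ψ₀ x' - fld ψ₀ x)
          + K₁ * (s / n) * (c * supN Φ)) + K₂ * (s / n) * (c * supN Φ)) + K₃ * (s / n) * (c * supN Φ)) := by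
        refine mul_le_mul_of_nonneg_left ?_ hρ
        exact (siteNorm_add_le _ _).trans (add_le_add ((siteNorm_add_le _ _).trans
          (add_le_add ((siteNorm_add_le _ _).trans (add_le_add le_rfl hia)) hiia)) hiib)
    _ = ρ * siteNorm ((gA x * (gA x')ᵀ) *ᵥ fld ψ₀ x' - fld ψ₀ x)
          + (K₁ + K₂ + K₃) * (ρ * (s / n)) * (c * supN Φ) := by ring
    _ ≤ cH * supN Φ + (K₁ + K₂ + K₃) * 1 * (c * supN Φ) := by
        refine add_le_add hib ?_
        exact mul_le_mul_of_nonneg_right (mul_le_mul_of_nonneg_left hr hK0) hXΦ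
    _ ≤ cH * supN Φ + 3 * ((d : ℝ) + 3) * (1 + ℓ₁) ^ 2 * (c * supN Φ) := by
        rw [mul_one]
        exact add_le_add le_rfl (mul_le_mul_of_nonneg_right hK hXΦ)
    _ = (cH + 3 * ((d : ℝ) + 3) * (1 + ℓ₁) ^ 2 * c) * supN Φ := by ring

end Key

/-! ## §6 (2.16) FOR `G_k(□,Ã)`: the transfer through the expansion (2.31)/(2.33) -/

section Main

variable {d : ℕ}

/-- **[B4] LEMMA 2.2, (2.16) — THE HÖLDER MEMBER FOR THE FIELD `Ã = A₀ + A′` ON FINE BOXES.**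
«Now using Lemma 2.2 for G_k(□,A₀) and the decomposition D^η_Ã = U(A')D^η_{A₀} + F_{1,k}(A'), we have»
«(2.33) ‖G_k(□,Ã)f‖_{1,α} ≤ O(1)c₁ Σ_{n=0}^∞ ‖(V_kG_k(□,A₀))^nf‖_∞ ≤ O(1)c₁ Σ_{n=0}^∞ (O(1)e^βc₂)^n‖f‖_∞.»
«The series on the right hand side is convergent for e sufficiently small, and we get the inequality (2.16).»
Here: for `G = G_k(□,Ã)` in resolvent form `G = G_k(□,A₀) + G_k(□,A₀)V_kG` (`B4Lemma22ReduceZero.greenA_resolvent`,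
the summed (2.31)) and `V_k` first-order small with `((d+2)c)ε ≤ 1/2` (the tree's form of «for e sufficiently
small»), the `α`-HÖLDER QUOTIENT of `D^η_{Ã,μ}GΦ` formed with the transport `U(Ã(Γ_{x,x′}))` along any
nearest-neighbour contour of length `≤ (d+1)|x−x′|_∞` is `≤ 2c₁‖Φ‖_∞`, `c₁` the constant of the KEY ESTIMATE
`holder_const_green` — by `B4Lemma22ReduceZero.lemma22_16_transfer_const` applied to the (subadditive) functional
`Ψ ↦ (n/|x−x′|)^α·|U(Ã(Γ_{x,x′}))(D^η_{Ã,μ}Ψ)(x′) − (D^η_{Ã,μ}Ψ)(x)|`.  Together with the sup members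
`B4Lemma22ReduceDeriv.lemma22_17_sup_field_regular` this is every member of the norm (2.14) of `G_k(□,Ã)Φ`, i.e.
(2.16) on fine boxes. [cite: Balaban1983RegularityDecay, Lemma 2.2 (2.16) p. 578; proof (2.31)–(2.33) p. 581] -/
theorem lemma22_16_holder_field (F : OrthFlow ι) {ℓ₁ : ℝ} (hℓ₁ : 0 ≤ ℓ₁)
    (hLip : ∀ t (v : ι → ℝ), ((F.U t - 1) *ᵥ v) ⬝ᵥ ((F.U t - 1) *ᵥ v) ≤ (ℓ₁ * t) ^ 2 * (v ⬝ᵥ v))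
    (κ : ℝ) (d ℓ : ℕ) (hℓ : 1 ≤ ℓ) (amin aplus m2plus : ℝ) (ha : 0 < amin) (α : ℝ) (hα0 : 0 ≤ α)
    (hα1 : α < 1) :
    ∃ c c₁ : ℝ, 0 < c ∧ 0 < c₁ ∧ ∀ (k : ℕ), 1 ≤ k → ∀ (a m2 : ℝ), amin ≤ a → a ≤ aplus → 0 ≤ m2 → m2 ≤ m2plus →
      ∀ (M : Fin (d + 1) → ℕ), (∀ i, 1 ≤ M i) →
      ∀ (emb : ↥(boxDom M) → ↥(Box d ℓ k M)) (Γ : ↥(boxDom M) → ↥(Box d ℓ k M) → List ↥(Box d ℓ k M)),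
        (∀ y x, blkWt ((ℓ + 1) ^ k) M (fun i => (ℓ + 1) ^ k * M i) y x ≠ 0 → pathEnd (emb y) (Γ y x) = x) →
      ∀ (A₀ : Fin (d + 1) → ℝ) (A' : ↥(Box d ℓ k M) → ↥(Box d ℓ k M) → ℝ) (θ θ' ε : ℝ),
        0 ≤ θ → θ ≤ 1 → 0 ≤ θ' → θ' ≤ 1 →
        (∀ ν, |κ * A₀ ν| ≤ θ / ((ℓ + 1) ^ k : ℕ)) →
        (∀ x y : ↥(Box d ℓ k M), y.1 ∈ nbrs x.1 → |κ * A' x y| ≤ θ / ((ℓ + 1) ^ k : ℕ)) →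
        (∀ (μ : Fin (d + 1)) (x xe x' xe' : ↥(Box d ℓ k M)), xe.1 = x.1 + e1 μ → xe'.1 = x'.1 + e1 μ →
          |κ * (A' x' xe' - A' x xe)|
            ≤ θ' * supNorm (x'.1 - x.1) / (((ℓ + 1) ^ k : ℕ) : ℝ) ^ 2) →
        IsUnit (opA d F κ ℓ k a m2 M emb Γ (constBond A₀ Subtype.val + A')).det →
        FirstOrderSmall supN (pertV d F κ ℓ k a M emb Γ A₀ A') (derivA0 d F κ ℓ k M A₀) ε → 0 ≤ ε →
        ((d : ℝ) + 2) * c * ε ≤ 1 / 2 →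
      ∀ (μ : Fin (d + 1)) (x xe x' xe' : ↥(Box d ℓ k M)),
        xe.1 = x.1 + e1 μ → xe'.1 = x'.1 + e1 μ → x'.1 ≠ x.1 →
      ∀ (l : List ↥(Box d ℓ k M)), IsNNChain x l → pathEnd x l = x' →
        (l.length : ℝ) ≤ ((d : ℝ) + 1) * supNorm (x'.1 - x.1) →
      ∀ Φ : ↥(Box d ℓ k M) × ι → ℝ,
        ((((ℓ + 1) ^ k : ℕ) : ℝ) / supNorm (x'.1 - x.1)) ^ α *
          siteNorm (transport (fieldLink F κ (constBond A₀ Subtype.val + A')) x l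
              *ᵥ fld (derivA d F κ ℓ k M (constBond A₀ Subtype.val + A') μ
                    *ᵥ (greenA d F κ ℓ k a m2 M emb Γ (constBond A₀ Subtype.val + A') *ᵥ Φ)) x'
            - fld (derivA d F κ ℓ k M (constBond A₀ Subtype.val + A') μ
                    *ᵥ (greenA d F κ ℓ k a m2 M emb Γ (constBond A₀ Subtype.val + A') *ᵥ Φ)) x)
          ≤ 2 * c₁ * supN Φ := by
  obtain ⟨c, hc, hTr⟩ := lemma22_16_transfer_const F κ d ℓ hℓ amin aplus m2plus ha
  obtain ⟨c₁, hc₁, hKey⟩ := holder_const_green F hℓ₁ hLip κ d ℓ hℓ amin aplus m2plus ha α hα0 hα1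
  refine ⟨c, c₁, hc, hc₁, ?_⟩
  intro k hk a m2 e1' e2 e3 e4 M hM emb Γ hend A₀ A' θ θ' ε hθ hθ1 hθ' hθ'1 hA0 hA' hA'' hunit hV hε hsm μ x xe
    x' xe' hxe hxe' hne l hl hlend hlen Φ
  have hres := greenA_resolvent F κ hℓ hk (lt_of_lt_of_le ha e1') e3 hM hend A₀ hunit
  -- the Hölder-quotient functional and its subadditivity
  have hρ : 0 ≤ ((((ℓ + 1) ^ k : ℕ) : ℝ) / supNorm (x'.1 - x.1)) ^ α :=
    holderWt_nonneg (Nat.cast_nonneg _) (supNorm_nonneg _)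
  have hsub : ∀ Ψ₁ Ψ₂ : ↥(Box d ℓ k M) × ι → ℝ,
      ((((ℓ + 1) ^ k : ℕ) : ℝ) / supNorm (x'.1 - x.1)) ^ α *
          siteNorm (transport (fieldLink F κ (constBond A₀ Subtype.val + A')) x l
              *ᵥ fld (derivA d F κ ℓ k M (constBond A₀ Subtype.val + A') μ *ᵥ (Ψ₁ + Ψ₂)) x'
            - fld (derivA d F κ ℓ k M (constBond A₀ Subtype.val + A') μ *ᵥ (Ψ₁ + Ψ₂)) x)
        ≤ ((((ℓ + 1) ^ k : ℕ) : ℝ) / supNorm (x'.1 - x.1)) ^ α *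
            siteNorm (transport (fieldLink F κ (constBond A₀ Subtype.val + A')) x l
                *ᵥ fld (derivA d F κ ℓ k M (constBond A₀ Subtype.val + A') μ *ᵥ Ψ₁) x'
              - fld (derivA d F κ ℓ k M (constBond A₀ Subtype.val + A') μ *ᵥ Ψ₁) x)
          + ((((ℓ + 1) ^ k : ℕ) : ℝ) / supNorm (x'.1 - x.1)) ^ α *
            siteNorm (transport (fieldLink F κ (constBond A₀ Subtype.val + A')) x l
                *ᵥ fld (derivA d F κ ℓ k M (constBond A₀ Subtype.val + A') μ *ᵥ Ψ₂) x'
              - fld (derivA d F κ ℓ k M (constBond A₀ Subtype.val + A') μ *ᵥ Ψ₂) x) := by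
    intro Ψ₁ Ψ₂
    rw [← mul_add]
    refine mul_le_mul_of_nonneg_left ?_ hρ
    rw [mulVec_add, fld_add, fld_add, mulVec_add]
    refine le_trans (le_of_eq ?_) (siteNorm_add_le _ _)
    congr 1
    abel
  exact hTr k hk a m2 e1' e2 e3 e4 M hM emb Γ hend A₀ _ _ ε hres hV hε hsm
    (fun Ψ => ((((ℓ + 1) ^ k : ℕ) : ℝ) / supNorm (x'.1 - x.1)) ^ α *
      siteNorm (transport (fieldLink F κ (constBond A₀ Subtype.val + A')) x l
          *ᵥ fld (derivA d F κ ℓ k M (constBond A₀ Subtype.val + A') μ *ᵥ Ψ) x'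
        - fld (derivA d F κ ℓ k M (constBond A₀ Subtype.val + A') μ *ᵥ Ψ) x))
    hsub c₁ hc₁.le
    (hKey k hk a m2 e1' e2 e3 e4 M hM emb Γ hend A₀ A' θ θ' hθ hθ1 hθ' hθ'1 hA0 hA' hA'' μ x xe x' xe' hxe hxe'
      hne l hl hlend hlen) Φ

end Main

/-! ## §7 (2.16)'s Hölder member with `V_k` FULLY DISCHARGED from (2.23)-type hypotheses -/

section Explicit

open Literature.MathematicalPhysics.QuantumFieldTheory.Balaban1983to89.B4Lower18Regular (lsum)
open Literature.MathematicalPhysics.QuantumFieldTheory.Balaban1983to89.B4Lemma22CrossSup (firstOrderSmall_cross)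
open Literature.MathematicalPhysics.QuantumFieldTheory.Balaban1983to89.B4Lemma22PertVSup (firstOrderSmall_pertV
  constBond_antisymm)

/-- **[B4] LEMMA 2.2 (2.16), HÖLDER MEMBER, FOR `G_k(□,Ã)` ON A FINE BOX WITH THE PERTURBATION `V_k` FULLY DISCHARGED**
— `lemma22_16_holder_field` with its first-order smallness hypothesis supplied by the tree's
`B4Lemma22CrossSup.firstOrderSmall_cross` + `B4Lemma22PertVSup.firstOrderSmall_pertV`, i.e. with exactly the field
hypotheses of `B4Lemma22CrossSup.lemma22_17_sup_box` ((2.17)_∞): `|κA'_b| ≤ θ/n` (size), `|κ(A'(b') − A'(b))| ≤ θ₂/n²` on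
consecutive parallel bonds (second differences), `A' = 0` on the bonds touching the faces («constant in a neighbourhood
of the boundary of □»), `|κA'(Γ_{y,x})| ≤ τ` on the block contours, the smallness
`(d+2)c((d+1)ℓ₁(θ+θ₂) + (d+1)ℓ₁θ + (d+1)ℓ₁²θ² + a_kℓ₁τ(2+ℓ₁τ)) ≤ 1/2` («for e sufficiently small»), PLUS the two inputs the
Hölder member consumes in addition (GAPS C-b04g15-6): `|κA₀,ν| ≤ θ/n` and the first-difference bound
`|κ(A'(x',x'+e_μ) − A'(x,x+e_μ))| ≤ θ'|x'−x|_∞/n²`, `θ, θ' ≤ 1`.  Conclusion: the transported Hölder quotient of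
`D^η_{Ã,μ}G_k(□,Ã)Φ` along any nearest-neighbour chain of length `≤ (d+1)|x'−x|_∞` is `≤ 2c₁‖Φ‖_∞`.
[cite: Balaban1983RegularityDecay, Lemma 2.2 (2.16) p. 578; (2.23) p. 580; (2.31)–(2.33) p. 581] -/
theorem lemma22_16_holder_field_explicit (F : OrthFlow ι) {ℓ₁ : ℝ} (hℓ₁ : 0 ≤ ℓ₁)
    (hLip : ∀ t (v : ι → ℝ), ((F.U t - 1) *ᵥ v) ⬝ᵥ ((F.U t - 1) *ᵥ v) ≤ (ℓ₁ * t) ^ 2 * (v ⬝ᵥ v))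
    (κ : ℝ) (d ℓ : ℕ) (hℓ : 1 ≤ ℓ) (amin aplus m2plus : ℝ) (ha : 0 < amin) (α : ℝ) (hα0 : 0 ≤ α)
    (hα1 : α < 1) :
    ∃ c c₁ : ℝ, 0 < c ∧ 0 < c₁ ∧ ∀ (k : ℕ), 1 ≤ k → ∀ (a m2 : ℝ), amin ≤ a → a ≤ aplus → 0 ≤ m2 → m2 ≤ m2plus →
      ∀ (M : Fin (d + 1) → ℕ), (∀ i, 1 ≤ M i) →
      ∀ (emb : ↥(boxDom M) → ↥(Box d ℓ k M)) (Γ : ↥(boxDom M) → ↥(Box d ℓ k M) → List ↥(Box d ℓ k M)),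
        (∀ y x, blkWt ((ℓ + 1) ^ k) M (fun i => (ℓ + 1) ^ k * M i) y x ≠ 0 → pathEnd (emb y) (Γ y x) = x) →
      ∀ (A₀ : Fin (d + 1) → ℝ) (A' : ↥(Box d ℓ k M) → ↥(Box d ℓ k M) → ℝ) (θ θ' θ₂ τ : ℝ),
        IsUnit (opA d F κ ℓ k a m2 M emb Γ (constBond A₀ Subtype.val + A')).det →
        0 ≤ θ → θ ≤ 1 → (∀ ν, |κ * A₀ ν| ≤ θ / ((ℓ + 1) ^ k : ℕ)) →
        (∀ x y : ↥(Box d ℓ k M), y.1 ∈ nbrs x.1 → |κ * A' x y| ≤ θ / ((ℓ + 1) ^ k : ℕ)) →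
        0 ≤ θ' → θ' ≤ 1 →
        (∀ (μ : Fin (d + 1)) (x xe x' xe' : ↥(Box d ℓ k M)), xe.1 = x.1 + e1 μ → xe'.1 = x'.1 + e1 μ →
          |κ * (A' x' xe' - A' x xe)|
            ≤ θ' * supNorm (x'.1 - x.1) / (((ℓ + 1) ^ k : ℕ) : ℝ) ^ 2) →
        0 ≤ θ₂ → (∀ (x z y : ↥(Box d ℓ k M)) (μ : Fin (d + 1)), z.1 = x.1 + e1 μ → y.1 = z.1 + e1 μ →
          |κ * (A' y z - A' z x)| ≤ θ₂ / (((ℓ + 1) ^ k : ℕ) : ℝ) ^ 2 ∧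
          |κ * (A' x z - A' z y)| ≤ θ₂ / (((ℓ + 1) ^ k : ℕ) : ℝ) ^ 2) →
        (∀ (x y : ↥(Box d ℓ k M)) (μ : Fin (d + 1)), y.1 = x.1 + e1 μ →
          (x.1 - e1 μ ∉ Box d ℓ k M ∨ y.1 + e1 μ ∉ Box d ℓ k M) → A' x y = 0 ∧ A' y x = 0) →
        0 ≤ τ → (∀ y x, blkWt ((ℓ + 1) ^ k) M (fun i => (ℓ + 1) ^ k * M i) y x ≠ 0 →
          |κ * lsum A' (emb y) (Γ y x)| ≤ τ) →
        ((d : ℝ) + 2) * c * (((d : ℝ) + 1) * ℓ₁ * (θ + θ₂) + ((d : ℝ) + 1) * ℓ₁ * θ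
          + ((d : ℝ) + 1) * ℓ₁ ^ 2 * θ ^ 2 + B1.aSeq a ((ℓ : ℝ) + 1) k * (ℓ₁ * τ * (2 + ℓ₁ * τ))) ≤ 1 / 2 →
      ∀ (μ : Fin (d + 1)) (x xe x' xe' : ↥(Box d ℓ k M)),
        xe.1 = x.1 + e1 μ → xe'.1 = x'.1 + e1 μ → x'.1 ≠ x.1 →
      ∀ (l : List ↥(Box d ℓ k M)), IsNNChain x l → pathEnd x l = x' →
        (l.length : ℝ) ≤ ((d : ℝ) + 1) * supNorm (x'.1 - x.1) →
      ∀ Φ : ↥(Box d ℓ k M) × ι → ℝ,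
        ((((ℓ + 1) ^ k : ℕ) : ℝ) / supNorm (x'.1 - x.1)) ^ α *
          siteNorm (transport (fieldLink F κ (constBond A₀ Subtype.val + A')) x l
              *ᵥ fld (derivA d F κ ℓ k M (constBond A₀ Subtype.val + A') μ
                    *ᵥ (greenA d F κ ℓ k a m2 M emb Γ (constBond A₀ Subtype.val + A') *ᵥ Φ)) x'
            - fld (derivA d F κ ℓ k M (constBond A₀ Subtype.val + A') μ
                    *ᵥ (greenA d F κ ℓ k a m2 M emb Γ (constBond A₀ Subtype.val + A') *ᵥ Φ)) x)
          ≤ 2 * c₁ * supN Φ := by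
  obtain ⟨c, c₁, hc, hc₁, h⟩ := lemma22_16_holder_field F hℓ₁ hLip κ d ℓ hℓ amin aplus m2plus ha α hα0 hα1
  refine ⟨c, c₁, hc, hc₁, ?_⟩
  intro k hk a m2 e1' e2 e3 e4 M hM emb Γ hend A₀ A' θ θ' θ₂ τ hunit hθ hθ1 hA0 hA' hθ' hθ'1 hA'' hθ₂ hder hbd hτ0 hτ
    hsm μ x xe x' xe' hxe hxe' hne l hl hlend hlen Φ
  have hn : 1 ≤ (ℓ + 1) ^ k := Nat.one_le_pow _ _ (Nat.succ_pos ℓ)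
  have hL : (1 : ℝ) < (ℓ : ℝ) + 1 := by
    have : (1 : ℝ) ≤ (ℓ : ℝ) := by exact_mod_cast hℓ
    linarith
  have ha' : 0 < a := lt_of_lt_of_le ha e1'
  have hak : 0 ≤ B1.aSeq a ((ℓ : ℝ) + 1) k := (B1.aSeq_pos ha' hL hk).le
  have hC := firstOrderSmall_cross F hℓ₁ hLip κ hn (fun i => (ℓ + 1) ^ k * M i) (constBond A₀ Subtype.val)
    (constBond_antisymm A₀ Subtype.val) hθ hA' hθ₂ hder hbd
  have hV := firstOrderSmall_pertV F hℓ₁ hLip κ hℓ hk ha' M emb Γ A₀ hθ hA' hτ0 hτ hC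
  have hε : 0 ≤ ((d : ℝ) + 1) * ℓ₁ * (θ + θ₂) + ((d : ℝ) + 1) * ℓ₁ * θ + ((d : ℝ) + 1) * ℓ₁ ^ 2 * θ ^ 2
      + B1.aSeq a ((ℓ : ℝ) + 1) k * (ℓ₁ * τ * (2 + ℓ₁ * τ)) := by positivity
  exact h k hk a m2 e1' e2 e3 e4 M hM emb Γ hend A₀ A' θ θ' _ hθ hθ1 hθ' hθ'1 hA0 hA' hA'' hunit hV hε hsm μ x xe x'
    xe' hxe hxe' hne l hl hlend hlen Φ

end Explicit

end

end Literature.MathematicalPhysics.QuantumFieldTheory.Balaban1983to89.B4Lemma22HolderBox
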